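import Summits.CriticalPhenomena.PercolationContinuityZ3.Theorems.PercNearOneGluingNoHeavyQuantCombCount
import Summits.CriticalPhenomena.PercolationContinuityZ3.Theorems.PercNearOneGluingNoHeavyQuantFarTreeRow
import HarnessLib

/-!
# QUANT lane R8: FAR AT EVERY LAYER ON COMBS — `Quant.FarTreeRow`'s conclusion for every rooted forest whose relays other than an
# argmin relay `a` leave `a`'s ancestral chain by pairwise disjoint private paths

builds on p205010 (kernel theorem, internal audit signed; external expert review pending)

Support file (`--supports stmt-CriticalPhenomena-4575`), QUANT lane seat prim-quant-p1 (gen 6), rung R8 of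
`run/shared/lean/prim/quant/LADDER.md`; memo `P1-SURPLUS.md` §17.  Theorems only; no sorries; standard axioms.

* `Quant.exists_enum_mono` — a finset can be enumerated with a given `ℕ`-valued key nondecreasing (selection sort).
* `Quant.farTreeRow_comb` — **FAR on combs, every layer** (gate coordinates of `Quant.FarTreeRow`): for ancestor finsets `P` of a rooted
  forest on `Fin m` (`y ∈ P x → P y ⊆ P x`; members of `P x` pairwise comparable), gates `q`, a relay set `A ∋ a` with
  `∏_{P a} q ≤ ∏_{P b} q` on `A` (`a` is a least likely relay) and `P b ∩ P b' ⊆ P a` for distinct `b, b' ∈ A ∖ a` (COMB: the other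
  relays hang off `a`'s ancestral chain by pairwise disjoint private parts; relays on the chain and relays glued to `a` are allowed),
  every layer `j` and every `t`:  `2j < Σ_{b∈A} ∏_{P b} q` and `1 − ∏_{P b} q ≤ t` on `A` imply `P(#{b ∈ A : ↑(P b) ⊆ ω} ≤ j) ≤ t`.
  This is the instance of `Quant.FarTreeRow` (OPEN for general branching trees) on the comb family, at EVERY layer `j` — beyond the
  kernel's previous all-layer families (spiders `Quant.far_indepLegs`, block-stars, hub + root blocks); it contains the near-tie
  'leafy hub + tied competitor' trees of LEAD-NOTES-G7 N15 with unit leaves when the argmin is taken at a hub leaf.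
  Proof: enumerate `A ∖ a` root-first (`exists_enum_mono` on the key `#(P b ∩ P a)`; chain parts are nested, `Quant.comb_downsets_nested`),
  write `P(N ≥ j+1) = Σ_k w k p k · PB[p, k] j + x · PB[p, K] j` (`Quant.comb_count_eq`), and apply the all-layer singles chain
  inequality `Quant.CountDP.sojourn_weighted` (the SOJOURN LEMMA of `…QuantSojourn.lean`): `w k · p k = P(b k reached) ≥ x = P(a reached)`
  and `x + Σ_k w k p k = E N > 2j`.  (Lead g8 LEAD-NOTES-G8 N19 (2) conjectured this family; the blob analogue of the sojourn route is false.)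
[this work]
-/

noncomputable section

namespace Summit.CriticalPhenomena.PercolationContinuityZ3.Theorems

namespace Quant

open Finset MeasureTheory
open Literature.Probability.LatticeModels
open Literature.Probability.Percolation
open scoped Classical

/-- `PB[p, m] b` = probability that exactly `b` of the first `m` independent trials succeed (recursion on `m`, as in `…QuantCountDP.lean`). -/
local notation3 "PB[" p ", " m "]" =>
  (Nat.rec (motive := fun _ => ℕ → ℝ) (fun b => if b = 0 then (1 : ℝ) else 0)
    (fun n f b => (p : ℕ → ℝ) n * (if b = 0 then (0 : ℝ) else f (b - 1)) + (1 - (p : ℕ → ℝ) n) * f b) (m : ℕ))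

variable {ι : Type*}

/-! ### Enumerating a finset with a nondecreasing key -/

/-- **Selection sort.**  A finset of cardinality `n` has an enumeration `b 0, …, b (n−1)` (injective, onto) along which a given key
`f : ι → ℕ` is nondecreasing (`d` is a default value used off `[0, n)`). [folklore] -/
theorem exists_enum_mono [DecidableEq ι] (f : ι → ℕ) (d : ι) : ∀ (n : ℕ) (S : Finset ι), S.card = n →
    ∃ b : ℕ → ι, (∀ k, k < n → b k ∈ S) ∧ (∀ k k', k < n → k' < n → b k = b k' → k = k') ∧
      (∀ y ∈ S, ∃ k, k < n ∧ b k = y) ∧ (∀ k k', k ≤ k' → k' < n → f (b k) ≤ f (b k')) := by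
  intro n
  induction n with
  | zero =>
    intro S hS
    rw [Finset.card_eq_zero] at hS
    subst hS
    exact ⟨fun _ => d, fun k hk => absurd hk (Nat.not_lt_zero k), fun k k' hk => absurd hk (Nat.not_lt_zero k),
      fun y hy => absurd hy (Finset.notMem_empty y), fun k k' _ hk' => absurd hk' (Nat.not_lt_zero k')⟩
  | succ n ih =>
    intro S hS
    have hne : S.Nonempty := by rw [← Finset.card_pos, hS]; omega
    obtain ⟨y₀, hy₀, hmin⟩ := Finset.exists_min_image S f hne
    have hcard : (S.erase y₀).card = n := by rw [Finset.card_erase_of_mem hy₀, hS]; rfl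
    obtain ⟨b', hb'mem, hb'inj, hb'cov, hb'mono⟩ := ih (S.erase y₀) hcard
    refine ⟨fun k => if k = 0 then y₀ else b' (k - 1), ?_, ?_, ?_, ?_⟩
    · intro k hk
      by_cases hk0 : k = 0
      · simp only [hk0, if_true]; exact hy₀
      · simp only [hk0, if_false]; exact Finset.mem_of_mem_erase (hb'mem (k - 1) (by omega))
    · intro k k' hk hk' h
      by_cases hk0 : k = 0 <;> by_cases hk0' : k' = 0
      · omega
      · simp only [hk0, if_true, hk0', if_false] at h
        have := hb'mem (k' - 1) (by omega)
        rw [← h] at this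
        exact absurd this (Finset.notMem_erase y₀ S)
      · simp only [hk0, if_false, hk0', if_true] at h
        have := hb'mem (k - 1) (by omega)
        rw [h] at this
        exact absurd this (Finset.notMem_erase y₀ S)
      · simp only [hk0, if_false, hk0'] at h
        have := hb'inj (k - 1) (k' - 1) (by omega) (by omega) h
        omega
    · intro y hy
      by_cases hyy : y = y₀
      · exact ⟨0, by omega, by simp [hyy]⟩
      · obtain ⟨k, hk, hky⟩ := hb'cov y (Finset.mem_erase.2 ⟨hyy, hy⟩)
        refine ⟨k + 1, by omega, ?_⟩
        simp only [Nat.add_one_ne_zero, if_false, Nat.add_sub_cancel]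
        exact hky
    · intro k k' hkk' hk'
      by_cases hk0 : k = 0
      · simp only [hk0, if_true]
        by_cases hk0' : k' = 0
        · simp only [hk0', if_true]; exact le_rfl
        · simp only [hk0', if_false]
          exact hmin _ (Finset.mem_of_mem_erase (hb'mem (k' - 1) (by omega)))
      · have hk0' : k' ≠ 0 := by omega
        simp only [hk0, hk0', if_false]
        exact hb'mono (k - 1) (k' - 1) (by omega) (by omega)

/-! ### FAR at every layer on combs -/

/-- **FAR AT EVERY LAYER ON COMBS** (gate coordinates; see the file header).  For ancestor finsets `P` of a rooted forest on `Fin m`, gates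
`q`, a relay set `A` with a least likely relay `a ∈ A` off whose ancestral chain the other relays hang by pairwise disjoint private parts
(`P b ∩ P b' ⊆ P a` for distinct `b, b' ∈ A ∖ a`), every `j` and `t`: `2j < Σ_{b∈A} ∏_{P b} q` and `1 − ∏_{P b} q ≤ t` (`b ∈ A`) give
`P(#{b ∈ A : ↑(P b) ⊆ ω} ≤ j) ≤ t` — the conclusion of `Quant.FarTreeRow` for this family, at every layer. [this work] -/
theorem farTreeRow_comb (m : ℕ) (P : Fin m → Finset (Fin m))
    (h2 : ∀ x, ∀ y ∈ P x, P y ⊆ P x) (h3 : ∀ x, ∀ y ∈ P x, ∀ z ∈ P x, y ∈ P z ∨ z ∈ P y)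
    (q : Fin m → unitInterval) (A : Finset (Fin m)) (j : ℕ) (t : ℝ) (a : Fin m) (ha : a ∈ A)
    (hmin : ∀ b ∈ A, ∏ y ∈ P a, (q y : ℝ) ≤ ∏ y ∈ P b, (q y : ℝ))
    (hcomb : ∀ b ∈ A, ∀ b' ∈ A, b ≠ a → b' ≠ a → b ≠ b' → P b ∩ P b' ⊆ P a)
    (hEN : (2 * j : ℝ) < ∑ b ∈ A, ∏ y ∈ P b, (q y : ℝ))
    (ht : ∀ b ∈ A, 1 - ∏ y ∈ P b, (q y : ℝ) ≤ t) :
    (prodBernoulli q).real {ω : Set (Fin m) | (A.filter fun b => ((P b : Finset (Fin m)) : Set (Fin m)) ⊆ ω).card ≤ j} ≤ t := by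
  set μ := prodBernoulli q with hμ
  have hmeas : ∀ T : Set (Set (Fin m)), MeasurableSet T := fun T => (Set.toFinite T).measurableSet
  have hq0 : ∀ y, (0 : ℝ) ≤ q y := fun y => (q y).2.1
  have hq1 : ∀ y, (q y : ℝ) ≤ 1 := fun y => (q y).2.2
  have hprod01 : ∀ s : Finset (Fin m), 0 ≤ ∏ y ∈ s, (q y : ℝ) ∧ ∏ y ∈ s, (q y : ℝ) ≤ 1 := fun s =>
    ⟨Finset.prod_nonneg fun y _ => hq0 y, Finset.prod_le_one (fun y _ => hq0 y) fun y _ => hq1 y⟩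
  set x : ℝ := ∏ y ∈ P a, (q y : ℝ) with hx
  -- it is enough to show `P(N ≥ j+1) ≥ x`
  suffices hge : x ≤ μ.real {ω : Set (Fin m) | j + 1 ≤ (A.filter fun b => ((P b : Finset (Fin m)) : Set (Fin m)) ⊆ ω).card} by
    have hcompl : {ω : Set (Fin m) | (A.filter fun b => ((P b : Finset (Fin m)) : Set (Fin m)) ⊆ ω).card ≤ j} =
        {ω : Set (Fin m) | j + 1 ≤ (A.filter fun b => ((P b : Finset (Fin m)) : Set (Fin m)) ⊆ ω).card}ᶜ := by
      ext ω; simp only [Set.mem_setOf_eq, Set.mem_compl_iff, not_le]; omega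
    rw [hcompl, probReal_compl_eq_one_sub (hmeas _)]
    linarith [ht a ha]
  rcases Nat.eq_zero_or_pos j with hj0 | hjpos
  · -- layer `0`: `a` reached suffices
    subst hj0
    rw [hx, ← prodBernoulli_real_subset q (P a)]
    refine measureReal_mono ?_ (measure_ne_top _ _)
    intro ω hω
    simp only [Set.mem_setOf_eq, zero_add] at hω ⊢
    exact Finset.card_pos.2 ⟨a, Finset.mem_filter.2 ⟨ha, hω⟩⟩
  -- enumerate the hairs root-first
  set S : Finset (Fin m) := A.erase a with hS
  obtain ⟨b, hbmem, hbinj, hbcov, hbmono⟩ := exists_enum_mono (fun y => (P y ∩ P a).card) a S.card S rfl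
  set K := S.card with hK
  have hb : ∀ k, k < K → b k ∈ A ∧ b k ≠ a := fun k hk =>
    ⟨Finset.mem_of_mem_erase (hbmem k hk), (Finset.mem_erase.1 (hbmem k hk)).1⟩
  have hcover : ∀ y ∈ A, y ≠ a → ∃ k, k < K ∧ b k = y := fun y hy hya => hbcov y (Finset.mem_erase.2 ⟨hya, hy⟩)
  have hmono : ∀ k k', k ≤ k' → k' < K → P (b k) ∩ P a ⊆ P (b k') ∩ P a := fun k k' hkk' hk' =>
    subset_of_nested_of_card_le (comb_downsets_nested P h2 h3 a (b k) (b k')) (hbmono k k' hkk' hk')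
  have hcomb' : ∀ k k', k < K → k' < K → k ≠ k' → P (b k) ∩ P (b k') ⊆ P a := fun k k' hk hk' hne =>
    hcomb (b k) (hb k hk).1 (b k') (hb k' hk').1 (hb k hk).2 (hb k' hk').2 fun h => hne (hbinj k k' hk hk' h)
  set p : ℕ → ℝ := fun k => ∏ y ∈ P (b k) \ P a, (q y : ℝ) with hp
  set w : ℕ → ℝ := fun k => ∏ y ∈ P (b k) ∩ P a, (q y : ℝ) with hw
  have hcount := comb_count_eq P q a x hx K A b p w ha hb hbinj hcover hmono hcomb' (fun k => rfl) (fun k => rfl)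
    (j + 1) (by omega)
  rw [Nat.add_sub_cancel] at hcount
  rw [hcount]
  -- the all-layer singles chain inequality
  have hp01 : ∀ k, 0 ≤ p k ∧ p k ≤ 1 := fun k => hprod01 _
  have hwp : ∀ k, w k * p k = ∏ y ∈ P (b k), (q y : ℝ) := by
    intro k
    rw [hw, hp]
    simp only
    rw [← Finset.prod_union (Finset.disjoint_sdiff_inter (P (b k)) (P a)).symm]
    congr 1
    ext y; simp only [Finset.mem_union, Finset.mem_inter, Finset.mem_sdiff]; tauto
  refine CountDP.sojourn_weighted p hp01 w x K j hjpos (hprod01 _).1 (hprod01 _).2 (fun k _ => (hprod01 _).2)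
    (fun k hk => by rw [hwp]; exact hmin (b k) (hb k hk).1) ?_
  -- the mean: `x + Σ_k w k p k = Σ_{b ∈ A} ∏_{P b} q`
  have himage : S = (Finset.range K).image b := by
    ext y
    constructor
    · intro hy
      obtain ⟨k, hk, rfl⟩ := hbcov y hy
      exact Finset.mem_image.2 ⟨k, Finset.mem_range.2 hk, rfl⟩
    · intro hy
      obtain ⟨k, hk, rfl⟩ := Finset.mem_image.1 hy
      exact hbmem k (Finset.mem_range.1 hk)
  have hsum : ∑ y ∈ A, ∏ z ∈ P y, (q z : ℝ) = x + ∑ k ∈ Finset.range K, w k * p k := by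
    rw [← Finset.add_sum_erase A _ ha, ← hS, himage, Finset.sum_image fun k hk k' hk' h =>
      hbinj k k' (Finset.mem_range.1 hk) (Finset.mem_range.1 hk') h]
    simp only [hwp]
    rw [hx]
  rw [← hsum]
  exact hEN

end Quant

end Summit.CriticalPhenomena.PercolationContinuityZ3.Theorems

end
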